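import Literature.AlgebraicGeometry.ShimuraVarieties.UnitaryCanonicalDescentPredicates
import HarnessLib

/-!
# Base change of canonical descent data up a tower `E' → E → ℂ`
# ([Deligne 1979] 2.2.5: a form over `E'` gives a form over every `E ⊇ E'`; [Milne 2005] Def. 12.8 (62) for the
# SMALLER group `Aut(ℂ/E) ⊆ Aut(ℂ/E')`)

Topic `AlgebraicGeometry/ShimuraVarieties`; namespace `Literature.AlgebraicGeometry.ShimuraVarieties.UnitaryCanonicalModel`.
THEOREMS ONLY (no definition, no named fact).  Cell hodgecm-mathlib (D-0151), fan A, KEY a1-reflex-compositum-model: the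
«trivial tower step» of stub (A) `stub_reflexCompositumModel` (A-plan1 ruling J3 (2)): an `E'`-form `(M', e')` of the
complex tower `Sc.Mc` with Shimura reciprocity (62) for `Aut(ℂ/ι'E')` (`IsCanonicalDescentOver Sc ι' M' e'`, B-typ03's
tree predicate) base-changes along any `j : E' →+* E` with `ιE ∘ j = ι'` to an `E`-form `(M' ⊗_{E'} E, e)` with (62) for
`Aut(ℂ/ιE E)` (`IsCanonicalDescentOver.tower`).  HC_CM is proved only modulo the 7 printed citations until rung 0 closes;
nothing here touches them.

Proof.  `M := M' ⋙ baseChangeHom j`; the form `e` is `e'` composed with the canonical comparison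
`(X' ⊗_{E'} E) ⊗_E ℂ ≅ X' ⊗_{E'} ℂ` (pasting of fibre squares, built by hand with `pullback.lift`, natural in `X'`,
compatible with the projections to `X'`); the reciprocity formula is transported through the injection
`Ψ : (M'_K ⊗ E)(ℂ)_E ↪ M'_K(ℂ)_{E'}`, `P ↦ P ≫ pr₁` (a point of the fibre product over `Spec E` is determined by its
first projection), which is `Aut(ℂ/E)`-equivariant and carries «the point read through `e`» to «the point read through
`e'`».

References: [Deligne1979ShimuraVarieties] 2.2.5; [Milne2005ShimuraVarieties] Def. 12.8 (62) p. 114, Rem. 12.9 p. 115.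
-/

set_option autoImplicit false

noncomputable section

open CategoryTheory CategoryTheory.Limits AlgebraicGeometry NumberField IsDedekindDomain Matrix
open Literature.AlgebraicGeometry.Motives
open Literature.NumberTheory.Automorphic Literature.NumberTheory.Automorphic.UnitaryGroup
open Literature.NumberTheory.Automorphic.Liu2021.AppendixC (C5.OpenCompactSubgroup C5.SmallLevel)
open Literature.Geometry.ComplexHyperbolic Literature.Geometry.ComplexHyperbolic.BallModel

namespace Literature.AlgebraicGeometry.ShimuraVarieties

namespace UnitaryCanonicalModel

universe u

section TowerIso

variable {E' E C : Type u} [Field E'] [Field E] [Field C] (j : E' →+* E) (ι : E →+* C)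

/-- **Pasting of fibre squares**: the comparison `(X' ⊗_{E'} E) ⊗_E C ≅ X' ⊗_{E'} C` of base changes along
`j : E' → E`, `ι : E → C` and `ι ∘ j`, natural in the `E'`-scheme `X'` and compatible (in both directions) with the
projections to `X'`. [folklore] -/
private theorem exists_towerIso :
    ∃ c : (baseChangeHom j ⋙ baseChangeHom ι) ≅ baseChangeHom (ι.comp j),
      ∀ X' : SchemeOver E',
        ((c.hom.app X').left : ((baseChangeHom ι).obj ((baseChangeHom j).obj X')).left ⟶
            ((baseChangeHom (ι.comp j)).obj X').left) ≫ baseChangeHomFst (ι.comp j) X' =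
          baseChangeHomFst ι ((baseChangeHom j).obj X') ≫ baseChangeHomFst j X' ∧
        ((c.inv.app X').left : ((baseChangeHom (ι.comp j)).obj X').left ⟶
            ((baseChangeHom ι).obj ((baseChangeHom j).obj X')).left) ≫
          baseChangeHomFst ι ((baseChangeHom j).obj X') ≫ baseChangeHomFst j X' = baseChangeHomFst (ι.comp j) X' := by
  have hSpec : Spec.map (CommRingCat.ofHom (ι.comp j)) =
      Spec.map (CommRingCat.ofHom ι) ≫ Spec.map (CommRingCat.ofHom j) := by
    rw [CommRingCat.ofHom_comp, Spec.map_comp]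
  -- the two underlying maps, on the explicit fibre products
  let hom : ∀ X' : SchemeOver E',
      pullback (pullback.snd X'.hom (Spec.map (CommRingCat.ofHom j))) (Spec.map (CommRingCat.ofHom ι)) ⟶
        pullback X'.hom (Spec.map (CommRingCat.ofHom (ι.comp j))) :=
    fun X' => pullback.lift (pullback.fst _ _ ≫ pullback.fst _ _) (pullback.snd _ _) (by
      rw [Category.assoc, pullback.condition, ← Category.assoc, pullback.condition, Category.assoc, ← hSpec])
  let inv : ∀ X' : SchemeOver E',
      pullback X'.hom (Spec.map (CommRingCat.ofHom (ι.comp j))) ⟶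
        pullback (pullback.snd X'.hom (Spec.map (CommRingCat.ofHom j))) (Spec.map (CommRingCat.ofHom ι)) :=
    fun X' => pullback.lift
      (pullback.lift (pullback.fst _ _) (pullback.snd _ _ ≫ Spec.map (CommRingCat.ofHom ι))
        (by rw [pullback.condition, Category.assoc, ← hSpec]))
      (pullback.snd _ _) (by rw [pullback.lift_snd])
  have hom_fst : ∀ X', hom X' ≫ pullback.fst _ _ = pullback.fst _ _ ≫ pullback.fst _ _ := fun X' =>
    pullback.lift_fst _ _ _
  have hom_snd : ∀ X', hom X' ≫ pullback.snd _ _ = pullback.snd _ _ := fun X' => pullback.lift_snd _ _ _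
  have inv_fst : ∀ X', inv X' ≫ pullback.fst _ _ =
      pullback.lift (pullback.fst _ _) (pullback.snd _ _ ≫ Spec.map (CommRingCat.ofHom ι))
        (by rw [pullback.condition, Category.assoc, ← hSpec]) := fun X' => pullback.lift_fst _ _ _
  have inv_snd : ∀ X', inv X' ≫ pullback.snd _ _ = pullback.snd _ _ := fun X' => pullback.lift_snd _ _ _
  have inv_fst_fst : ∀ X', inv X' ≫ pullback.fst _ _ ≫ pullback.fst _ _ = pullback.fst _ _ := fun X' => by
    rw [← Category.assoc, inv_fst, pullback.lift_fst]
  have hom_inv : ∀ X', hom X' ≫ inv X' = 𝟙 _ := fun X' => by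
    apply pullback.hom_ext
    · apply pullback.hom_ext
      · simp only [Category.assoc, Category.id_comp, inv_fst, pullback.lift_fst, hom_fst]
      · simp only [Category.assoc, Category.id_comp, inv_fst, pullback.lift_snd]
        rw [← Category.assoc, hom_snd]
        exact pullback.condition.symm
    · simp only [Category.assoc, Category.id_comp, inv_snd, hom_snd]
  have inv_hom : ∀ X', inv X' ≫ hom X' = 𝟙 _ := fun X' => by
    apply pullback.hom_ext
    · simp only [Category.assoc, Category.id_comp, hom_fst]
      rw [← Category.assoc, inv_fst, pullback.lift_fst]
    · simp only [Category.assoc, Category.id_comp, hom_snd, inv_snd]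
  -- the Over-isomorphisms `(X' ⊗ E) ⊗ C ≅ X' ⊗ C`
  let cX : ∀ X' : SchemeOver E',
      (baseChangeHom ι).obj ((baseChangeHom j).obj X') ≅ (baseChangeHom (ι.comp j)).obj X' :=
    fun X' => Over.isoMk ⟨hom X', inv X', hom_inv X', inv_hom X'⟩ (hom_snd X')
  refine ⟨NatIso.ofComponents cX (fun {X' Y'} f => ?_), fun X' => ⟨hom_fst X', inv_fst_fst X'⟩⟩
  -- naturality: explicit forms of the two induced maps
  set A : pullback (pullback.snd X'.hom (Spec.map (CommRingCat.ofHom j))) (Spec.map (CommRingCat.ofHom ι)) ⟶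
      pullback (pullback.snd Y'.hom (Spec.map (CommRingCat.ofHom j))) (Spec.map (CommRingCat.ofHom ι)) :=
    ((baseChangeHom ι).map ((baseChangeHom j).map f)).left with hA
  set B : pullback X'.hom (Spec.map (CommRingCat.ofHom (ι.comp j))) ⟶
      pullback Y'.hom (Spec.map (CommRingCat.ofHom (ι.comp j))) :=
    ((baseChangeHom (ι.comp j)).map f).left with hB
  set Bj : pullback X'.hom (Spec.map (CommRingCat.ofHom j)) ⟶ pullback Y'.hom (Spec.map (CommRingCat.ofHom j)) :=
    ((baseChangeHom j).map f).left with hBj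
  have h1 : A ≫ pullback.fst (pullback.snd Y'.hom (Spec.map (CommRingCat.ofHom j))) (Spec.map (CommRingCat.ofHom ι)) =
      pullback.fst (pullback.snd X'.hom (Spec.map (CommRingCat.ofHom j))) (Spec.map (CommRingCat.ofHom ι)) ≫ Bj :=
    baseChangeHom_map_left_comp_fst ι ((baseChangeHom j).map f)
  have h2 : Bj ≫ pullback.fst Y'.hom (Spec.map (CommRingCat.ofHom j)) =
      pullback.fst X'.hom (Spec.map (CommRingCat.ofHom j)) ≫ f.left :=
    baseChangeHom_map_left_comp_fst j f
  have hAsnd : A ≫ pullback.snd (pullback.snd Y'.hom (Spec.map (CommRingCat.ofHom j))) (Spec.map (CommRingCat.ofHom ι)) =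
      pullback.snd (pullback.snd X'.hom (Spec.map (CommRingCat.ofHom j))) (Spec.map (CommRingCat.ofHom ι)) :=
    Over.w ((baseChangeHom ι).map ((baseChangeHom j).map f))
  have hBfst : B ≫ pullback.fst Y'.hom (Spec.map (CommRingCat.ofHom (ι.comp j))) =
      pullback.fst X'.hom (Spec.map (CommRingCat.ofHom (ι.comp j))) ≫ f.left :=
    baseChangeHom_map_left_comp_fst (ι.comp j) f
  have hBsnd : B ≫ pullback.snd Y'.hom (Spec.map (CommRingCat.ofHom (ι.comp j))) =
      pullback.snd X'.hom (Spec.map (CommRingCat.ofHom (ι.comp j))) := Over.w _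
  have key : A ≫ hom Y' = hom X' ≫ B := by
    apply pullback.hom_ext
    · rw [Category.assoc, hom_fst, ← Category.assoc, h1]
      simp only [Category.assoc]
      rw [h2, hBfst, reassoc_of% (hom_fst X')]
    · rw [Category.assoc, hom_snd, hAsnd, Category.assoc, hBsnd, hom_snd]
  ext : 1
  exact key

end TowerIso

section Descent

variable {L : Type} [Field L] [NumberField L] [IsCMField L] {H : Matrix (Fin 3) (Fin 3) L}
  {τ : L →+* ℂ} {T : GL (Fin 3) ℂ} {hT : formCongr (starRingEnd ℂ) T (H.map τ) = BallModel.J}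
  {K₀ : C5.OpenCompactSubgroup ↥(finAdelic (↥(maximalRealSubfield L)) L (IsCMField.complexConj L) 3 H)}

/-- **The tower step for canonical descent data**: an `E'`-form `(M', e')` of the complex tower `Sc.Mc` whose complex
points satisfy Shimura reciprocity (62) for `Aut(ℂ/ι'E')` gives, for every `j : E' →+* E` and `ιE : E →+* ℂ` with
`ιE ∘ j = ι'`, the `E`-form `(M' ⊗_{E'} E, e)` satisfying (62) for the smaller group `Aut(ℂ/ιE E)` — [Deligne1979ShimuraVarieties]
2.2.5 («a form over `E(G,X)`» base-changed to `E ⊇ E(G,X)`), [Milne2005ShimuraVarieties] Def. 12.8 read for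
`σ ∈ Aut(ℂ/E) ⊆ Aut(ℂ/E')`.  The idèle convention (finite idèles of `L`, `IsArtinCorrespondent L τ`) is unchanged, so
no norm map intervenes. [cite: Deligne1979ShimuraVarieties, 2.2.5 (PDF p. 29 of Milne's translation)]
[cite: Milne2005ShimuraVarieties, Def. 12.8 (62) p. 114 and Rem. 12.9 p. 115] -/
theorem IsCanonicalDescentOver.tower (Sc : ComplexRecordSystem L H τ T hT K₀) {E' E : Type} [Field E'] [Field E]
    (j : E' →+* E) (ιE : E →+* ℂ) {ι' : E' →+* ℂ} (hι : ιE.comp j = ι')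
    (M' : C5.SmallLevel K₀ ⥤ SchemeOver E') (e' : (M' ⋙ baseChangeHom ι') ≅ Sc.Mc)
    (h' : IsCanonicalDescentOver Sc ι' M' e') :
    ∃ (M : C5.SmallLevel K₀ ⥤ SchemeOver E) (e : (M ⋙ baseChangeHom ιE) ≅ Sc.Mc), IsCanonicalDescentOver Sc ιE M e := by
  subst hι
  letI instE : Algebra E ℂ := ιE.toAlgebra
  letI instE' : Algebra E' ℂ := (ιE.comp j).toAlgebra
  have hSpec : Spec.map (CommRingCat.ofHom (ιE.comp j)) =
      Spec.map (CommRingCat.ofHom ιE) ≫ Spec.map (CommRingCat.ofHom j) := by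
    rw [CommRingCat.ofHom_comp, Spec.map_comp]
  obtain ⟨c, hc⟩ := exists_towerIso j ιE
  let M : C5.SmallLevel K₀ ⥤ SchemeOver E := M' ⋙ baseChangeHom j
  let e : (M ⋙ baseChangeHom ιE) ≅ Sc.Mc := Functor.isoWhiskerLeft M' c ≪≫ e'
  -- the comparison of points `Ψ_K : (M'_K ⊗ E)(ℂ)_E → M'_K(ℂ)_{E'}`, `P ↦ P ≫ pr₁`
  have hΨw : ∀ (K : C5.SmallLevel K₀) (P : AlgPoints ((baseChangeHom j).obj (M'.obj K)) ℂ),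
      (P.left ≫ baseChangeHomFst j (M'.obj K)) ≫ (M'.obj K).hom =
        Spec.map (CommRingCat.ofHom (algebraMap E' ℂ)) := by
    intro K P
    have hcond : baseChangeHomFst j (M'.obj K) ≫ (M'.obj K).hom =
        ((baseChangeHom j).obj (M'.obj K)).hom ≫ Spec.map (CommRingCat.ofHom j) := pullback.condition
    have hP : P.left ≫ ((baseChangeHom j).obj (M'.obj K)).hom = Spec.map (CommRingCat.ofHom (algebraMap E ℂ)) :=
      Over.w P
    rw [Category.assoc, hcond, ← Category.assoc, hP]
    change Spec.map (CommRingCat.ofHom ιE) ≫ Spec.map (CommRingCat.ofHom j) = Spec.map (CommRingCat.ofHom (ιE.comp j))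
    rw [hSpec]
  let Ψ : ∀ K : C5.SmallLevel K₀, AlgPoints ((baseChangeHom j).obj (M'.obj K)) ℂ → AlgPoints (M'.obj K) ℂ :=
    fun K P => Over.homMk (P.left ≫ baseChangeHomFst j (M'.obj K)) (hΨw K P)
  have hΨleft : ∀ (K) (P : AlgPoints ((baseChangeHom j).obj (M'.obj K)) ℂ),
      (Ψ K P).left = P.left ≫ baseChangeHomFst j (M'.obj K) := fun K P => rfl
  have hΨinj : ∀ K, Function.Injective (Ψ K) := by
    intro K P Q hPQ
    have h1 := congrArg (fun R : AlgPoints (M'.obj K) ℂ => R.left) hPQ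
    simp only [hΨleft] at h1
    apply Over.OverMorphism.ext
    apply pullback.hom_ext
    · exact h1
    · exact (Over.w P).trans (Over.w Q).symm
  have hΨsmul : ∀ (K) (σ : ℂ ≃ₐ[E] ℂ) (P : AlgPoints (M.obj K) ℂ),
      Ψ K (σ • P) = (AlgEquiv.ofRingEquiv (f := σ.toRingEquiv) (fun x => σ.commutes (j x)) : ℂ ≃ₐ[E'] ℂ) • Ψ K P := by
    intro K σ P
    apply Over.OverMorphism.ext
    exact Category.assoc _ _ _
  -- reading a point of `M_K = M'_K ⊗ E` through `e` and projecting = reading it through `e'`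
  have hΨform : ∀ (K : C5.SmallLevel K₀) (u : ComplexPoints (Sc.Mc.obj K)),
      Ψ K ((AlgPoints.baseChangeEquiv ιE (M.obj K)).symm (AlgPoints.map (e.inv.app K) u)) =
        (AlgPoints.baseChangeEquiv (ιE.comp j) (M'.obj K)).symm (AlgPoints.map (e'.inv.app K) u) := by
    intro K u
    apply Over.OverMorphism.ext
    let eL : (Sc.Mc.obj K).left ⟶ ((baseChangeHom (ιE.comp j)).obj (M'.obj K)).left := (e'.inv.app K).left
    let cL : ((baseChangeHom (ιE.comp j)).obj (M'.obj K)).left ⟶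
        ((baseChangeHom ιE).obj ((baseChangeHom j).obj (M'.obj K))).left := (c.inv.app (M'.obj K)).left
    have key : cL ≫ baseChangeHomFst ιE ((baseChangeHom j).obj (M'.obj K)) ≫ baseChangeHomFst j (M'.obj K) =
        baseChangeHomFst (ιE.comp j) (M'.obj K) := (hc (M'.obj K)).2
    have hl : (Ψ K ((AlgPoints.baseChangeEquiv ιE (M.obj K)).symm (AlgPoints.map (e.inv.app K) u))).left =
        ((u.left ≫ eL ≫ cL) ≫ baseChangeHomFst ιE ((baseChangeHom j).obj (M'.obj K))) ≫
          baseChangeHomFst j (M'.obj K) :=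
      congrArg (fun t => t ≫ baseChangeHomFst j (M'.obj K))
        (AlgPoints.baseChangeEquiv_symm_apply_left ιE (M.obj K) (AlgPoints.map (e.inv.app K) u))
    have hr : ((AlgPoints.baseChangeEquiv (ιE.comp j) (M'.obj K)).symm (AlgPoints.map (e'.inv.app K) u)).left =
        (u.left ≫ eL) ≫ baseChangeHomFst (ιE.comp j) (M'.obj K) :=
      AlgPoints.baseChangeEquiv_symm_apply_left (ιE.comp j) (M'.obj K) (AlgPoints.map (e'.inv.app K) u)
    rw [hl, hr, Category.assoc, Category.assoc, Category.assoc, key]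
    exact (Category.assoc _ _ _).symm
  refine ⟨M, e, ?_⟩
  intro K σ s hs v₃ x hx d hd a
  apply hΨinj K
  rw [hΨsmul, hΨform, hΨform]
  exact h' K _ s hs v₃ x hx d hd a

end Descent


end UnitaryCanonicalModel

end Literature.AlgebraicGeometry.ShimuraVarieties

end
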